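import Literature.NumberTheory.Rogawski1990.CartanAlgebra
import Literature.NumberTheory.QuadraticForms.LandherrHermitianMatrices
import HarnessLib

/-!
# Realisation of a Cartan class by a rational element of the stable class: `H·x ≅ H` over the CM field iff the signatures
# and the discriminant class agree (Landherr), and then `δ := g γ g⁻¹ ∈ U(H)(F)` with `inv(γ, δ) = [x]`
# (Rogawski 1990, §3.1 p. 19, §3.3 Prop. 3.3.1 p. 22, §3.5 Prop. 3.5.2 p. 29; Kottwitz 1986 §9; Landherr 1936)

Topic `NumberTheory/Rogawski1990`; namespace `Literature.NumberTheory.Rogawski1990`; **THEOREMS ONLY** (no definition, no named fact, no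
instance, no notation, no `sorry`).  Cell `pub/hodgecm-mathlib`, ENGINE T1 (crux H413 = `stmt-HodgeConjecture-24833`), row G6 «pre-stabilisation
for the `U(3)` tori», sub-row R6a of `CENSUS-R6R7-CartanObstruction.F0P5a-p03g4`: the GLOBAL-EXISTENCE half of Kottwitz's criterion (Prop. 3.3.1,
direction (→) «`κ(obs γ′) = 1 ∀ κ` ⇒ `γ′` is `G`-conjugate to a rational element»), on top of ★ `CartanInvariant` (`twistGram σ H g = ᵗ(σg) H g`),
★ `CartanAlgebra` (`hermStar σ H x = H⁻¹ ᵗ(σx) H`, `cartanAlgebra γ = Z(γ)`) and ★ LANDHERR'S THEOREM `QuadraticForms.hermitianMatrices_congruent_iff_invariants`.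
HC_CM is proved only modulo the printed citations until rung 0 closes.

THE MATHEMATICS.  Let `R` be a commutative ring with involution `σ`, `H ∈ GL_n(R)` `σ`-hermitian, `γ ∈ U(H)(R)`.  The `U(H)(R)`-classes in the
stable class of `γ` are read on `γ`-INVARIANT hermitian forms: for `g γ g⁻¹ = δ ∈ U(H)(R)` the transported form `H_g = ᵗ(σg) H g` is `H · x`,
`x = H⁻¹ H_g ∈ Z(γ)` `τ`-symmetric (★ `commute_inv_mul_twistGram`, ★ `hermStar_inv_mul_twistGram`), and CONVERSELY (§1 here) every `x ∈ Z(γ)` with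
`H_g = H · x` for some `g ∈ GL_n(R)` makes `g γ g⁻¹` UNITARY (`conj_mem_unitaryGroup_of_twistGram_eq_mul`) — a rational element of the stable class
with Cartan class `[x]`.  Over the CM field `L` (`σ` = complex conjugation, `F = L⁺`), WHICH `τ`-symmetric units `x ∈ Z(γ)` are realised, i.e. satisfy
`H · x ≅ H`?  By Landherr's theorem [Landherr1936; ★ `hermitianMatrices_congruent_iff_invariants`]: iff `H · x` and `H` have the same signature at
every complex embedding `ρ : L → ℂ` and `det x = N_{L∕F}(z) = z σ(z)` for some `z ∈ Lˣ` (§2, `exists_gl_twistGram_eq_mul_iff_invariants`).  This is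
the step «then `γ′` is conjugate to a rational `δ`» in the proof of [Rogawski1990, Prop. 3.3.1] for `G = U(H)`: the Hasse principle for the simply
connected `SU(H)` enters exactly through Landherr's local-global classification of hermitian forms; the local conditions (signatures at `∞`,
`det x` a local norm everywhere ⇒ a global norm by Hasse for `L∕F`) are what the vanishing of the obstruction supplies (files R6d∕R7 of the census).

* §1 (any `R`): `det_twistGram`, `det_inv_mul_twistGram` (`det(H⁻¹ H_g) = σ(det g) · det g` — the source of the «sum zero» constraint on `obs`),
  `conjTranspose_mul_eq_mul_hermStar` (`ᵗ(σ(Hx)) = H x⋆`: `H x` is hermitian iff `x⋆ = x`), `twistGram_mul_eq_of_eq_mul` and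
  **`conj_mem_unitaryGroup_of_twistGram_eq_mul`** (`H_g = H x`, `x ∈ Z(γ)` ⇒ `g γ g⁻¹ ∈ U(H)(R)`), `inv_mul_twistGram_eq_of_eq_mul` (its Cartan class IS `x`);
  §1b the converse uniqueness **`exists_unitary_conj_of_twistGram_eq`** ∕ `exists_unitary_conj_of_inv_mul_twistGram_eq` (same Cartan class modulo norms ⇒
  `U(H)(R)`-conjugate) — with §1 the `U(H)(R)`-classes in the stable class of `γ` inject into `{x ∈ (Z(γ)^⋆)ˣ} ∕ N(Z(γ)ˣ)` with image the REALISED classes.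
* §2 (`R = L` a CM field): **`exists_gl_twistGram_eq_mul_iff_invariants`** and the realisation **`exists_unitary_conj_inv_mul_twistGram_eq_of_invariants`**:
  `∃ g ∈ GL_n(L), ∃ δ ∈ U(H)(L⁺)`, `g γ g⁻¹ = δ` (so `γ ∼_st δ`, ★ `isStablyConj_iff`) and `H⁻¹ H_g = x`.

## References
* [Rogawski1990] J. D. Rogawski, *Automorphic Representations of Unitary Groups in Three Variables*, Ann. of Math. Stud. 123 (1990), §3.1 p. 19, §3.3
  Prop. 3.3.1 p. 22, §3.5 Prop. 3.5.2 p. 29.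
* [Kottwitz1986] R. E. Kottwitz, *Stable trace formula: elliptic singular terms*, Math. Ann. 275 (1986), §9.
* [Landherr1936HermitianForms] W. Landherr, *Äquivalenz Hermitescher Formen über einem beliebigen algebraischen Zahlkörper*, Abh. Math. Sem. Hamburg 11
  (1936) 245–248; G. Shimura, *Arithmetic of hermitian forms*, Doc. Math. 13 (2008), Thm. 2.2.
-/

set_option autoImplicit false

noncomputable section

namespace Literature.NumberTheory.Rogawski1990

open scoped MatrixGroups Matrix
open Literature.AlgebraicGeometry.ShimuraVarieties (unitaryGroup mem_unitaryGroup_iff)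

/-! ## §1 Over a commutative ring with involution: determinants, hermitian twists `H · x`, and unitarity of `g γ g⁻¹` when `H_g = H · x` -/

section General

variable {R : Type*} [CommRing R] {n : Type*} [Fintype n] [DecidableEq n] (σ : R →+* R) (H : Matrix n n R)

/-- `det H_g = σ(det g) · det H · det g`. [cite: Rogawski1990, §3.1 p. 19] -/
theorem det_twistGram (g : Matrix n n R) : (twistGram σ H g).det = σ g.det * H.det * g.det := by
  rw [twistGram_def, Matrix.det_mul, Matrix.det_mul, Matrix.det_transpose, ← RingHom.mapMatrix_apply, ← RingHom.map_det]

/-- **`det (H⁻¹ H_g) = σ(det g) · det g = N(det g)`** for `H` invertible: the determinant of a Cartan class is a NORM from `R` to `R^σ` — the source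
of the «sum zero» constraint `obs ∈ A(T) = {∑ εⱼ = 0}`. [cite: Rogawski1990, §3.5 Prop. 3.5.2 p. 29] -/
theorem det_inv_mul_twistGram (hH : IsUnit H.det) (g : Matrix n n R) : (H⁻¹ * twistGram σ H g).det = σ g.det * g.det := by
  rw [Matrix.det_mul, det_twistGram, Matrix.det_nonsing_inv,
    show Ring.inverse H.det * (σ g.det * H.det * g.det) = (Ring.inverse H.det * H.det) * (σ g.det * g.det) by ring,
    Ring.inverse_mul_cancel _ hH, one_mul]

/-- `ᵗ(σ(H x)) = H · x⋆` for `H` hermitian invertible (`x⋆ = hermStar σ H x = H⁻¹ ᵗ(σx) H`). [cite: Rogawski1990, §3.5 p. 29] -/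
theorem conjTranspose_mul_eq_mul_hermStar (hH : (H.map σ)ᵀ = H) (hHu : IsUnit H.det) (x : Matrix n n R) :
    ((H * x).map σ)ᵀ = H * hermStar σ H x := by
  rw [hermStar_def, Matrix.map_mul, Matrix.transpose_mul, hH, ← Matrix.mul_assoc, ← Matrix.mul_assoc, Matrix.mul_nonsing_inv H hHu,
    Matrix.one_mul]

/-- Hence **`H · x` is `σ`-hermitian iff `x⋆ = x`** (`H` hermitian invertible). [cite: Rogawski1990, §3.5 p. 29] -/
theorem conjTranspose_mul_eq_self_iff (hH : (H.map σ)ᵀ = H) (hHu : IsUnit H.det) (x : Matrix n n R) :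
    ((H * x).map σ)ᵀ = H * x ↔ hermStar σ H x = x := by
  rw [conjTranspose_mul_eq_mul_hermStar σ H hH hHu]
  refine ⟨fun h => ?_, fun h => by rw [h]⟩
  have h' := congrArg (fun M => H⁻¹ * M) h
  simpa only [← Matrix.mul_assoc, Matrix.nonsing_inv_mul H hHu, Matrix.one_mul] using h'

/-- If `H_g = H · x` with `x` commuting with `γ ∈ U(H)(R)`, then `H_{g γ} = H_g` (`ᵗ(σγ) (H x) γ = ᵗ(σγ) H γ x = H x`). [cite: Rogawski1990, §3.1 p. 19] -/
theorem twistGram_mul_eq_of_eq_mul {γ : GL n R} (hγ : γ ∈ unitaryGroup σ H) {x g : Matrix n n R} (hx : Commute x (γ : Matrix n n R))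
    (hgx : twistGram σ H g = H * x) : twistGram σ H (g * (γ : Matrix n n R)) = twistGram σ H g := by
  rw [twistGram_mul, hgx]
  conv_rhs => rw [← twistGram_coe_eq_of_mem_unitaryGroup σ H hγ, twistGram_def]
  simp only [Matrix.mul_assoc, hx.eq]

/-- **Realisation, ring form: if `H_g = H · x` with `x ∈ Z(γ)` then `g γ g⁻¹ ∈ U(H)(R)`** — every `γ`-invariant hermitian form congruent to `H` is
the transported form of a rational element of the stable class of `γ`. [cite: Rogawski1990, §3.1 p. 19; §3.3 Prop. 3.3.1 p. 22] -/
theorem conj_mem_unitaryGroup_of_twistGram_eq_mul {γ : GL n R} (hγ : γ ∈ unitaryGroup σ H) {x : Matrix n n R} (hx : Commute x (γ : Matrix n n R))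
    {g : GL n R} (hgx : twistGram σ H (g : Matrix n n R) = H * x) : g * γ * g⁻¹ ∈ unitaryGroup σ H := by
  rw [← twistGram_coe_eq_iff_mem_unitaryGroup, Units.val_mul, Units.val_mul, twistGram_mul, twistGram_mul_eq_of_eq_mul σ H hγ hx hgx,
    ← twistGram_mul, ← Units.val_mul, mul_inv_cancel, Units.val_one, twistGram_one]

/-- … and its Cartan class `H⁻¹ H_g` is `x` itself. [cite: Rogawski1990, §3.1 p. 19] -/
theorem inv_mul_twistGram_eq_of_eq_mul (hH : IsUnit H.det) {x g : Matrix n n R} (hgx : twistGram σ H g = H * x) : H⁻¹ * twistGram σ H g = x := by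
  rw [hgx, ← Matrix.mul_assoc, Matrix.nonsing_inv_mul H hH, Matrix.one_mul]

/-- The realised element packaged in `U(H)(R)`: `∃ δ ∈ U(H)(R)` with `g γ g⁻¹ = δ` — so `γ ∼_st δ` (★ `isStablyConj_iff`) — and `H⁻¹ H_g = x`.
[cite: Rogawski1990, §3.1 p. 19; §3.3 Prop. 3.3.1 p. 22] -/
theorem exists_unitary_conj_eq_of_twistGram_eq_mul (hH : IsUnit H.det) (γ : unitaryGroup σ H) {x : Matrix n n R}
    (hx : Commute x ((γ : GL n R) : Matrix n n R)) {g : GL n R} (hgx : twistGram σ H (g : Matrix n n R) = H * x) :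
    ∃ δ : unitaryGroup σ H, g * (γ : GL n R) * g⁻¹ = δ ∧ IsStablyConj σ H γ δ ∧ H⁻¹ * twistGram σ H (g : Matrix n n R) = x :=
  ⟨⟨g * (γ : GL n R) * g⁻¹, conj_mem_unitaryGroup_of_twistGram_eq_mul σ H γ.2 hx hgx⟩, rfl, isStablyConj_iff.mpr ⟨g, rfl⟩,
    inv_mul_twistGram_eq_of_eq_mul σ H hH hgx⟩

/-! ### §1b Conversely: two elements of the stable class with the same Cartan class modulo norms are `U(H)(R)`-conjugate -/

/-- **Same transported form up to `Z(γ)` ⇒ `U(H)(R)`-conjugate**: if `g γ g⁻¹ = δ`, `g′ γ g′⁻¹ = δ′` and `H_{g′} = H_{g t}` for some `t` commuting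
with `γ`, then `u := g t g′⁻¹ ∈ U(H)(R)` and `u δ′ u⁻¹ = δ` — the INJECTIVITY of `δ ↦ [H⁻¹ H_g] ∈ (Z(γ)^⋆)ˣ ∕ N` on `U(H)(R)`-classes within the stable
class (the case `δ′ = γ`, `g′ = 1` is ★ `exists_unitary_conj_iff_exists_commute_twistGram_eq`). [cite: Rogawski1990, §3.1 p. 19] [cite: Kottwitz1986, §7] -/
theorem exists_unitary_conj_of_twistGram_eq {γ δ δ' g g' t : GL n R} (hg : g * γ * g⁻¹ = δ) (hg' : g' * γ * g'⁻¹ = δ') (ht : t * γ = γ * t)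
    (h : twistGram σ H (g' : Matrix n n R) = twistGram σ H ((g * t : GL n R) : Matrix n n R)) :
    ∃ u : GL n R, u ∈ unitaryGroup σ H ∧ u * δ' * u⁻¹ = δ := by
  refine ⟨g * t * g'⁻¹, ?_, ?_⟩
  · rw [← twistGram_coe_eq_iff_mem_unitaryGroup, Units.val_mul, twistGram_mul, ← h, ← twistGram_mul, ← Units.val_mul, mul_inv_cancel,
      Units.val_one, twistGram_one]
  · rw [← hg', ← hg]
    calc g * t * g'⁻¹ * (g' * γ * g'⁻¹) * (g * t * g'⁻¹)⁻¹ = g * (t * γ * t⁻¹) * g⁻¹ := by simp only [mul_assoc, mul_inv_rev, inv_inv, inv_mul_cancel_left]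
      _ = g * γ * g⁻¹ := by rw [ht, mul_inv_cancel_right]

/-- The same in CARTAN-CLASS currency (`H` invertible): `H⁻¹ H_{g′} = t⋆ · (H⁻¹ H_g) · t` with `t ∈ Z(γ)` (i.e. the classes agree modulo norms, ★
`inv_mul_twistGram_mul`) ⇒ `δ′ ∼_{U(H)(R)} δ`. [cite: Rogawski1990, §3.1 p. 19; §3.5 Prop. 3.5.2 p. 29] -/
theorem exists_unitary_conj_of_inv_mul_twistGram_eq (hH : IsUnit H.det) {γ δ δ' g g' t : GL n R} (hg : g * γ * g⁻¹ = δ) (hg' : g' * γ * g'⁻¹ = δ')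
    (ht : t * γ = γ * t)
    (h : H⁻¹ * twistGram σ H (g' : Matrix n n R) = hermStar σ H (t : Matrix n n R) * (H⁻¹ * twistGram σ H (g : Matrix n n R)) * (t : Matrix n n R)) :
    ∃ u : GL n R, u ∈ unitaryGroup σ H ∧ u * δ' * u⁻¹ = δ := by
  refine exists_unitary_conj_of_twistGram_eq σ H hg hg' ht ?_
  rw [← inv_mul_twistGram_mul σ H hH] at h
  -- cancel `H⁻¹`
  have h' := congrArg (fun M => H * M) h
  simpa only [← Matrix.mul_assoc, Matrix.mul_nonsing_inv H hH, Matrix.one_mul, Units.val_mul] using h'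

end General

/-! ## §2 Over a CM field: `H · x ≅ H` iff signatures and discriminant class agree (Landherr), and the realisation -/

section CMField

open NumberField Literature.NumberTheory.Automorphic Literature.NumberTheory.QuadraticForms

variable (L : Type) [Field L] [NumberField L] [IsCMField L] {n : Type} [Fintype n] [DecidableEq n]

omit [Fintype n] [DecidableEq n] in
/-- Dictionary: ★ `Landherr.conjTranspose L A` (`= Aᵀ.map (IsCMField.complexConj L)`, [Landherr1936]'s `ᵗĀ`) is `(A.map (cmConjRingHom L))ᵀ`, the
spelling of ★ `unitaryGroup` ∕ ★ `twistGram`. [cite: Landherr1936HermitianForms] -/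
theorem landherr_conjTranspose_eq (A : Matrix n n L) : Landherr.conjTranspose L A = (A.map (cmConjRingHom L))ᵀ := by
  ext i j
  rfl

omit [Fintype n] [DecidableEq n] in
/-- `ρ(H)` is a hermitian complex matrix for `H` `σ`-hermitian and `ρ : L → ℂ` a complex embedding (★ `Landherr.isHermitian_map` in ★ `twistGram`'s
spelling) — the proof callers feed to the signature clauses below. [cite: Landherr1936HermitianForms] -/
theorem isHermitian_map_embedding {H : Matrix n n L} (hH : (H.map (cmConjRingHom L))ᵀ = H) (ρ : L →+* ℂ) : (H.map ρ).IsHermitian :=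
  Landherr.isHermitian_map L ((landherr_conjTranspose_eq L H).trans hH) ρ

/-- **`H · x ≅ H` over the CM field iff the invariants agree** [Landherr]: for `H` hermitian non-degenerate and `x` with `x⋆ = x`, `det x ≠ 0`:
`(∃ g ∈ GL_n(L), ᵗ(σg) H g = H · x)` iff (i) at every complex embedding `ρ` the hermitian matrices `ρ(H)` and `ρ(H x)` have the same number of positive
eigenvalues and (ii) `det x = z · σ(z)` for some `z ∈ Lˣ` (`det(Hx) = det H · det x`: equality of discriminants in `L⁺ˣ ∕ N(Lˣ)`).
[cite: Landherr1936HermitianForms] [cite: Rogawski1990, §3.5 Prop. 3.5.2 p. 29] -/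
theorem exists_gl_twistGram_eq_mul_iff_invariants {H : Matrix n n L} (hH : (H.map (cmConjRingHom L))ᵀ = H) (h0 : H.det ≠ 0) {x : Matrix n n L}
    (hx : hermStar (cmConjRingHom L) H x = x) (hx0 : x.det ≠ 0) :
    (∃ g : GL n L, twistGram (cmConjRingHom L) H (g : Matrix n n L) = H * x) ↔
      (∀ (ρ : L →+* ℂ) (h₁ : (H.map ρ).IsHermitian) (h₂ : ((H * x).map ρ).IsHermitian),
          (Finset.univ.filter fun i => 0 < h₁.eigenvalues i).card = (Finset.univ.filter fun i => 0 < h₂.eigenvalues i).card) ∧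
        ∃ z : L, z ≠ 0 ∧ x.det = z * cmConjRingHom L z := by
  have hH' : Landherr.conjTranspose L H = H := (landherr_conjTranspose_eq L H).trans hH
  have hHx' : Landherr.conjTranspose L (H * x) = H * x :=
    (landherr_conjTranspose_eq L (H * x)).trans ((conjTranspose_mul_eq_self_iff (cmConjRingHom L) H hH (Ne.isUnit h0) x).mpr hx)
  have h0x : (H * x).det ≠ 0 := by rw [Matrix.det_mul]; exact mul_ne_zero h0 hx0
  have key := hermitianMatrices_congruent_iff_invariants L H (H * x) (by rw [Matrix.transpose_map]; exact hH)
    (by rw [Matrix.transpose_map]; exact (conjTranspose_mul_eq_self_iff (cmConjRingHom L) H hH (Ne.isUnit h0) x).mpr hx) h0 h0x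
  -- LHS: Landherr's congruence is `twistGram`
  have hL : (∃ g : GL n L, ((g : Matrix n n L).transpose.map (IsCMField.complexConj L)) * H * (g : Matrix n n L) = H * x) ↔
      ∃ g : GL n L, twistGram (cmConjRingHom L) H (g : Matrix n n L) = H * x := by
    refine exists_congr fun g => ?_
    rw [twistGram_def, Matrix.transpose_map]
    rfl
  rw [← hL, key]
  refine and_congr ⟨fun h ρ _ _ => h ρ, fun h ρ => h ρ _ _⟩ ⟨?_, ?_⟩
  · rintro ⟨z, hz, hdet⟩
    rw [Matrix.det_mul] at hdet
    -- `det H = det H · det x · z σz` ⇒ `det x · (z σ z) = 1` ⇒ `det x = z⁻¹ σ(z⁻¹)`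
    have h1 : 1 = x.det * (z * cmConjRingHom L z) := mul_left_cancel₀ h0 (by rw [mul_one, ← mul_assoc]; exact hdet)
    refine ⟨z⁻¹, inv_ne_zero hz, ?_⟩
    rw [map_inv₀, ← mul_inv]
    exact eq_inv_of_mul_eq_one_left h1.symm
  · rintro ⟨z, hz, hdet⟩
    have hσz : cmConjRingHom L z ≠ 0 := (map_ne_zero _).mpr hz
    refine ⟨z⁻¹, inv_ne_zero hz, ?_⟩
    rw [Matrix.det_mul, hdet, map_inv₀]
    simp only [cmConjRingHom_apply] at hσz ⊢
    field_simp

/-- **REALISATION OF A CARTAN CLASS (the global-existence half of Prop. 3.3.1 (→))**: `γ ∈ U(H)(L⁺)` (`H` hermitian non-degenerate over the CM field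
`L`), `x ∈ Z(γ)` with `x⋆ = x`, `det x ≠ 0`; if `ρ(H x)` and `ρ(H)` have the same signature at every complex embedding `ρ` and `det x ∈ N_{L∕L⁺}(Lˣ)`,
then there are `g ∈ GL_n(L)` and `δ ∈ U(H)(L⁺)` with `g γ g⁻¹ = δ` — so `γ ∼_st δ` — and Cartan class `H⁻¹ H_g = x`.  (By ★ R1
`exists_unitary_conj_iff_exists_norm_eq` the `U(H)(L⁺)`-class of `δ` is determined by `[x] ∈ (Z(γ)^⋆)ˣ ∕ N`.)
[cite: Rogawski1990, §3.3 Prop. 3.3.1 p. 22; §3.5 Prop. 3.5.2 p. 29] [cite: Kottwitz1986, §9] [cite: Landherr1936HermitianForms] -/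
theorem exists_unitary_conj_inv_mul_twistGram_eq_of_invariants {H : Matrix n n L} (hH : (H.map (cmConjRingHom L))ᵀ = H) (h0 : H.det ≠ 0)
    (γ : unitaryGroup (cmConjRingHom L) H) {x : Matrix n n L} (hxγ : Commute x ((γ : GL n L) : Matrix n n L))
    (hx : hermStar (cmConjRingHom L) H x = x) (hx0 : x.det ≠ 0)
    (hsig : ∀ (ρ : L →+* ℂ) (h₁ : (H.map ρ).IsHermitian) (h₂ : ((H * x).map ρ).IsHermitian),
      (Finset.univ.filter fun i => 0 < h₁.eigenvalues i).card = (Finset.univ.filter fun i => 0 < h₂.eigenvalues i).card)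
    (hdisc : ∃ z : L, z ≠ 0 ∧ x.det = z * cmConjRingHom L z) :
    ∃ (g : GL n L) (δ : unitaryGroup (cmConjRingHom L) H),
      g * (γ : GL n L) * g⁻¹ = δ ∧ IsStablyConj (cmConjRingHom L) H γ δ ∧ H⁻¹ * twistGram (cmConjRingHom L) H (g : Matrix n n L) = x := by
  obtain ⟨g, hg⟩ := (exists_gl_twistGram_eq_mul_iff_invariants L hH h0 hx hx0).mpr ⟨hsig, hdisc⟩
  obtain ⟨δ, hδ, hst, hcl⟩ := exists_unitary_conj_eq_of_twistGram_eq_mul (cmConjRingHom L) H (Ne.isUnit h0) γ hxγ hg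
  exact ⟨g, δ, hδ, hst, hcl⟩

end CMField

end Literature.NumberTheory.Rogawski1990

end
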